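import Summits.AtomisticToContinuum.Crystallization.Theorems.FrustratedLawDichotomyCollarNonExemptAniso

/-!
# FrustratedLawDichotomy · crux `AperiodicFrustratedLawGap` (stmt-AtomisticToContinuum-27623) — ZONED closed-form move certificates for the
# exemption of record (decomp-a2c, prover hand 2, generation 17; critic rows 590 (3) / 592 (3); sibling of `…CollarNonExemptAniso`)

The Bregman constant of a bond is the minimum of the secant curvature of `Ṽ` over the bond's range `[(r − t)², (r + t)²]` for moves of length `≤ t`;
at the move radius of record `t = s = 1/20` that range is wide, and the certified on-site stiffness is `λ(A) ≈ 11.4` against a true `½λ_min(Hess) ≈ 17.4`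
(float, cells of record).  ZONES repair this with NO branch-and-bound in the continuum — only a 1-D partition `0 < s₀ < s₁ < … < s` of the move LENGTH:

* §1 ★ `moveEnergy_ge_on_ball_of_aniso` — on an inner ball `‖d‖ ≤ t` the anisotropic certificate of `…CollarNonExemptAniso` (data at radius `t`,
  allowance `γ` a free parameter) bounds the energy change below by `−γ`;
  ★ `moveEnergy_ge_on_shell_of_iso` — on a shell `t₀ ≤ ‖d‖ ≤ t` the isotropic quartic `−φ_F ρ + λρ² − βρ³ + C₄ρ⁴` (data at radius `t`) is bounded
  below by its parabola minorant at `ρ = t₀` as soon as the vertex `φ_F/(2L)` lies left of `t₀` (`L = λ − βt + min(C₄,0)t²`): the scalar condition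
  is `φ_F t₀ ≤ L t₀² + γ`, LINEAR in `φ_F` (`shell_condition`);
* §2 ★★ `not_moveUnstableCore_of_twoZone` (ball `s₀` + shell `[s₀, s]`) and ★★ `not_moveUnstableCore_of_threeZone` (ball `s₀` + shells `[s₀, s₁]`,
  `[s₁, s]`), each zone with ITS OWN range/Bregman data, at the allowance `γ = ε + slack(s, Rm)` of `MoveUnstableCore ε Rm s`.
Float check (this generation, `calc/movecert.py` on the cells of record, 64-piece menu constants): cellT3 (hand-1 g15, `|F| = 0.190`, true gain
`4.74·10⁻⁴` vs allowance `6.68·10⁻⁴`) — one-zone isotropic FAILS (`L = 11.3 < 13.5`), one-zone anisotropic FAILS (bound `7.2·10⁻⁴`), ★ TWO ZONES with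
`s₀ = 1/50` CERTIFY (inner bound `5.6·10⁻⁴`, shell margin `1.4·10⁻³`); TEQ15 (census g19, `|F| = 0.108`) passes already isotropically (`L = 11.0 ≥ 4.4`);
TEQ60 (`|F| = 0.216`, true margin 10 %) needs three zones; TEQ65 (true margin 3 %) is out of reach of closed forms by design.
All `[folklore]` (elementary real algebra); 0 sorry; no definitions.
-/

noncomputable section

namespace Summit.AtomisticToContinuum.Crystallization.Theorems.FrustratedLawDichotomyCollarNonExemptZones

open scoped BigOperators Classical RealInnerProductSpace
open Literature.MathematicalPhysics.StatisticalMechanics (lennardJones)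
open Summit.AtomisticToContinuum.Crystallization.Theorems.FrustratedLawDichotomyExemptAbsorptionRecord (MoveUnstableCore)
open Summit.AtomisticToContinuum.Crystallization.Theorems.FrustratedLawDichotomyCollarNonExemptAniso

/-! ## §1. Zone lemmas (allowance `γ` free) -/

/-- ★ **INNER BALL**: Bregman data valid for moves of length `≤ t` (`hrange`, `hbreg`), `β ≥ ‖Σ 4c_k w_k‖`, `C₄⁻ ≤ min(Σ c_k, 0)`, `μ ≥ 0` and the
anisotropic certificate `∀ ‖d‖ ≤ t, 0 ≤ ⟪F,d⟫ + (S − βt + C₄⁻t² + μ)‖d‖² + 4Σ c_k⟪w_k,d⟫² + (γ − μt²)` bound the local energy change of every move of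
length `≤ t` below by `−γ`. [folklore] -/
theorem moveEnergy_ge_on_ball_of_aniso {Rm t γ : ℝ} {N : ℕ} {y : Fin N → EuclideanSpace ℝ (Fin 3)} {j : Fin N}
    (c Plo Phi : Fin N → ℝ) (beta C4m mu : ℝ) (hC4m : C4m ≤ 0) (hmu : 0 ≤ mu)
    (hrange : ∀ k ∈ (Finset.univ.erase j).filter (fun k => dist (y k) (y j) ≤ Rm), ∀ p : EuclideanSpace ℝ (Fin 3),
      dist p (y j) ≤ t → Plo k ≤ dist p (y k) ^ 2 ∧ dist p (y k) ^ 2 ≤ Phi k)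
    (hbreg : ∀ k ∈ (Finset.univ.erase j).filter (fun k => dist (y k) (y j) ≤ Rm), ∀ P : ℝ, Plo k ≤ P → P ≤ Phi k →
      c k * (P - dist (y j) (y k) ^ 2) ^ 2 ≤
        ((1 / 12) * P⁻¹ ^ 6 - (1 / 6) * P⁻¹ ^ 3) - ((1 / 12) * (dist (y j) (y k) ^ 2)⁻¹ ^ 6 - (1 / 6) * (dist (y j) (y k) ^ 2)⁻¹ ^ 3) -
          (-(1 / 2) * (dist (y j) (y k) ^ 2)⁻¹ ^ 7 + (1 / 2) * (dist (y j) (y k) ^ 2)⁻¹ ^ 4) * (P - dist (y j) (y k) ^ 2))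
    (hB : ‖∑ k ∈ (Finset.univ.erase j).filter (fun k => dist (y k) (y j) ≤ Rm), (4 * c k) • (y j - y k)‖ ≤ beta)
    (hC4 : C4m ≤ ∑ k ∈ (Finset.univ.erase j).filter (fun k => dist (y k) (y j) ≤ Rm), c k)
    (hN : ∀ d : EuclideanSpace ℝ (Fin 3), ‖d‖ ≤ t →
      0 ≤ ⟪∑ k ∈ (Finset.univ.erase j).filter (fun k => dist (y k) (y j) ≤ Rm),
              (2 * (-(1 / 2) * (dist (y j) (y k) ^ 2)⁻¹ ^ 7 + (1 / 2) * (dist (y j) (y k) ^ 2)⁻¹ ^ 4)) • (y j - y k), d⟫ +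
            ((∑ k ∈ (Finset.univ.erase j).filter (fun k => dist (y k) (y j) ≤ Rm),
                (-(1 / 2) * (dist (y j) (y k) ^ 2)⁻¹ ^ 7 + (1 / 2) * (dist (y j) (y k) ^ 2)⁻¹ ^ 4)) - beta * t + C4m * t ^ 2 + mu) *
              ‖d‖ ^ 2 +
            4 * (∑ k ∈ (Finset.univ.erase j).filter (fun k => dist (y k) (y j) ≤ Rm), c k * ⟪y j - y k, d⟫ ^ 2) + (γ - mu * t ^ 2)) :
    ∀ p : EuclideanSpace ℝ (Fin 3), dist p (y j) ≤ t →
      -γ ≤ (∑ k ∈ (Finset.univ.erase j).filter (fun k => dist (y k) (y j) ≤ Rm), lennardJones (dist p (y k))) -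
        ∑ k ∈ (Finset.univ.erase j).filter (fun k => dist (y k) (y j) ≤ Rm), lennardJones (dist (y j) (y k)) := by
  intro p hp
  set K := (Finset.univ.erase j).filter (fun k => dist (y k) (y j) ≤ Rm) with hK
  have hmodel := moveEnergy_sub_ge_model c Plo Phi hrange hbreg p hp
  have hd : ‖p - y j‖ ≤ t := by rwa [← dist_eq_norm]
  have han := model_ge_aniso K c (fun k => y j - y k)
    (∑ k ∈ K, (2 * (-(1 / 2) * (dist (y j) (y k) ^ 2)⁻¹ ^ 7 + (1 / 2) * (dist (y j) (y k) ^ 2)⁻¹ ^ 4)) • (y j - y k))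
    (∑ k ∈ K, (4 * c k) • (y j - y k)) (p - y j)
    (S := ∑ k ∈ K, (-(1 / 2) * (dist (y j) (y k) ^ 2)⁻¹ ^ 7 + (1 / 2) * (dist (y j) (y k) ^ 2)⁻¹ ^ 4)) hB hC4 hC4m hd
  have hcert := hN (p - y j) hd
  have hμ : mu * ‖p - y j‖ ^ 2 ≤ mu * t ^ 2 := mul_le_mul_of_nonneg_left (pow_le_pow_left₀ (norm_nonneg _) hd 2) hmu
  nlinarith

/-- ★ **The shell scalar condition** (`γ` free): `β ≥ 0`, `0 ≤ t₀`, `L = λ − βt + min(C₄,0)t² > 0`, `φ_F ≤ 2Lt₀` and `φ_F t₀ ≤ L t₀² + γ` give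
`−γ ≤ −φ_F ρ + λρ² − βρ³ + C₄ρ⁴` on the shell `t₀ ≤ ρ ≤ t`. [folklore] -/
theorem shell_condition {γ t t₀ lam beta phiF C4 : ℝ} (hbeta : 0 ≤ beta) (ht₀ : 0 ≤ t₀)
    (hL : 0 < lam - beta * t + min C4 0 * t ^ 2) (hvert : phiF ≤ 2 * (lam - beta * t + min C4 0 * t ^ 2) * t₀)
    (hcert : phiF * t₀ ≤ (lam - beta * t + min C4 0 * t ^ 2) * t₀ ^ 2 + γ) :
    ∀ ρ : ℝ, t₀ ≤ ρ → ρ ≤ t → -γ ≤ -phiF * ρ + lam * ρ ^ 2 - beta * ρ ^ 3 + C4 * ρ ^ 4 := by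
  intro ρ hρ0 hρs
  set L := lam - beta * t + min C4 0 * t ^ 2 with hLdef
  have hρ : 0 ≤ ρ := ht₀.trans hρ0
  have hm0 : min C4 0 ≤ 0 := min_le_right _ _
  have hmC : min C4 0 ≤ C4 := min_le_left _ _
  have hρ2 : ρ ^ 2 ≤ t ^ 2 := pow_le_pow_left₀ hρ hρs 2
  -- the quartic dominates `−φ_F ρ + L ρ²` on `[0, t]`
  have hdom : -phiF * ρ + L * ρ ^ 2 ≤ -phiF * ρ + lam * ρ ^ 2 - beta * ρ ^ 3 + C4 * ρ ^ 4 := by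
    have e1 : beta * ρ ^ 3 ≤ beta * t * ρ ^ 2 := by
      have := mul_le_mul_of_nonneg_left hρs (mul_nonneg hbeta (sq_nonneg ρ))
      nlinarith
    have e2 : min C4 0 * t ^ 2 * ρ ^ 2 ≤ C4 * ρ ^ 4 := by
      have a1 : min C4 0 * t ^ 2 ≤ min C4 0 * ρ ^ 2 := mul_le_mul_of_nonpos_left hρ2 hm0
      have a2 : min C4 0 * ρ ^ 2 * ρ ^ 2 ≤ C4 * ρ ^ 2 * ρ ^ 2 :=
        mul_le_mul_of_nonneg_right (mul_le_mul_of_nonneg_right hmC (sq_nonneg ρ)) (sq_nonneg ρ)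
      have a3 := mul_le_mul_of_nonneg_right a1 (sq_nonneg ρ)
      nlinarith
    rw [hLdef]
    nlinarith
  -- on the shell the parabola is increasing: value at `ρ` ≥ value at `t₀`
  have hmono : -phiF * t₀ + L * t₀ ^ 2 ≤ -phiF * ρ + L * ρ ^ 2 := by
    have hfac : -phiF * ρ + L * ρ ^ 2 - (-phiF * t₀ + L * t₀ ^ 2) = (ρ - t₀) * (L * (ρ + t₀) - phiF) := by ring
    have hnn : 0 ≤ (ρ - t₀) * (L * (ρ + t₀) - phiF) := mul_nonneg (by linarith) (by nlinarith [hL.le])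
    linarith
  linarith

/-- ★ **SHELL**: isotropic Bregman data valid for moves of length `≤ t` (`hrange`, `hbreg`, `hA`, `hB`, `hF`, `hC4`, `β ≥ 0`) and the shell scalar
condition at `t₀ ≥ 0` bound the local energy change of every move of length in `[t₀, t]` below by `−γ`. [folklore] -/
theorem moveEnergy_ge_on_shell_of_iso {Rm t t₀ γ : ℝ} {N : ℕ} {y : Fin N → EuclideanSpace ℝ (Fin 3)} {j : Fin N}
    (c Plo Phi : Fin N → ℝ) (lam beta phiF C4 : ℝ) (hbeta : 0 ≤ beta) (ht₀ : 0 ≤ t₀)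
    (hrange : ∀ k ∈ (Finset.univ.erase j).filter (fun k => dist (y k) (y j) ≤ Rm), ∀ p : EuclideanSpace ℝ (Fin 3),
      dist p (y j) ≤ t → Plo k ≤ dist p (y k) ^ 2 ∧ dist p (y k) ^ 2 ≤ Phi k)
    (hbreg : ∀ k ∈ (Finset.univ.erase j).filter (fun k => dist (y k) (y j) ≤ Rm), ∀ P : ℝ, Plo k ≤ P → P ≤ Phi k →
      c k * (P - dist (y j) (y k) ^ 2) ^ 2 ≤
        ((1 / 12) * P⁻¹ ^ 6 - (1 / 6) * P⁻¹ ^ 3) - ((1 / 12) * (dist (y j) (y k) ^ 2)⁻¹ ^ 6 - (1 / 6) * (dist (y j) (y k) ^ 2)⁻¹ ^ 3) -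
          (-(1 / 2) * (dist (y j) (y k) ^ 2)⁻¹ ^ 7 + (1 / 2) * (dist (y j) (y k) ^ 2)⁻¹ ^ 4) * (P - dist (y j) (y k) ^ 2))
    (hA : ∀ v : EuclideanSpace ℝ (Fin 3),
      lam * ‖v‖ ^ 2 ≤ (∑ k ∈ (Finset.univ.erase j).filter (fun k => dist (y k) (y j) ≤ Rm),
          (-(1 / 2) * (dist (y j) (y k) ^ 2)⁻¹ ^ 7 + (1 / 2) * (dist (y j) (y k) ^ 2)⁻¹ ^ 4)) * ‖v‖ ^ 2 +
        4 * ∑ k ∈ (Finset.univ.erase j).filter (fun k => dist (y k) (y j) ≤ Rm), c k * ⟪y j - y k, v⟫ ^ 2)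
    (hB : ‖∑ k ∈ (Finset.univ.erase j).filter (fun k => dist (y k) (y j) ≤ Rm), (4 * c k) • (y j - y k)‖ ≤ beta)
    (hF : ‖∑ k ∈ (Finset.univ.erase j).filter (fun k => dist (y k) (y j) ≤ Rm),
      (2 * (-(1 / 2) * (dist (y j) (y k) ^ 2)⁻¹ ^ 7 + (1 / 2) * (dist (y j) (y k) ^ 2)⁻¹ ^ 4)) • (y j - y k)‖ ≤ phiF)
    (hC4 : C4 ≤ ∑ k ∈ (Finset.univ.erase j).filter (fun k => dist (y k) (y j) ≤ Rm), c k)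
    (hL : 0 < lam - beta * t + min C4 0 * t ^ 2) (hvert : phiF ≤ 2 * (lam - beta * t + min C4 0 * t ^ 2) * t₀)
    (hcert : phiF * t₀ ≤ (lam - beta * t + min C4 0 * t ^ 2) * t₀ ^ 2 + γ) :
    ∀ p : EuclideanSpace ℝ (Fin 3), t₀ ≤ dist p (y j) → dist p (y j) ≤ t →
      -γ ≤ (∑ k ∈ (Finset.univ.erase j).filter (fun k => dist (y k) (y j) ≤ Rm), lennardJones (dist p (y k))) -
        ∑ k ∈ (Finset.univ.erase j).filter (fun k => dist (y k) (y j) ≤ Rm), lennardJones (dist (y j) (y k)) := by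
  intro p hp0 hp
  set K := (Finset.univ.erase j).filter (fun k => dist (y k) (y j) ≤ Rm) with hK
  have hdn : ‖p - y j‖ = dist p (y j) := by rw [dist_eq_norm]
  have hmodel := moveEnergy_sub_ge_model c Plo Phi hrange hbreg p hp
  have hiso := model_ge_iso K c (fun k => y j - y k)
    (∑ k ∈ K, (2 * (-(1 / 2) * (dist (y j) (y k) ^ 2)⁻¹ ^ 7 + (1 / 2) * (dist (y j) (y k) ^ 2)⁻¹ ^ 4)) • (y j - y k))
    (∑ k ∈ K, (4 * c k) • (y j - y k)) (p - y j)
    (S := ∑ k ∈ K, (-(1 / 2) * (dist (y j) (y k) ^ 2)⁻¹ ^ 7 + (1 / 2) * (dist (y j) (y k) ^ 2)⁻¹ ^ 4)) hA hB hF hC4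
  have hout := shell_condition hbeta ht₀ hL hvert hcert ‖p - y j‖ (by rwa [hdn]) (by rwa [hdn])
  linarith

/-! ## §2. Assemblies at the allowance of the predicate -/

/-- ★★ **TWO ZONES** (`0 ≤ s₀`): inner ball `‖d‖ ≤ s₀` by `moveEnergy_ge_on_ball_of_aniso` (data `c₀, Plo₀, Phi₀, β₀, C₄⁻₀, μ` at radius `s₀`),
shell `[s₀, s]` by `moveEnergy_ge_on_shell_of_iso` (data `c, Plo, Phi, λ, β, φ_F, C₄` at radius `s`), both at the allowance `γ = ε + slack(s, Rm)`
⟹ the site passes the move test `¬MoveUnstableCore ε Rm s`. [folklore] -/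
theorem not_moveUnstableCore_of_twoZone {ε Rm s s₀ : ℝ} {N : ℕ} {y : Fin N → EuclideanSpace ℝ (Fin 3)} {j : Fin N} (hs₀ : 0 ≤ s₀)
    (hball : ∀ p : EuclideanSpace ℝ (Fin 3), dist p (y j) ≤ s₀ →
      -(ε + s * (Rm / (Rm - s)) ^ 7 * (6000 / 343 * Rm⁻¹ ^ 4 + 2880 / 49 * Rm⁻¹ ^ 5 + 10 / 7 * Rm⁻¹ ^ 6 + 2 * Rm⁻¹ ^ 7)) ≤
        (∑ k ∈ (Finset.univ.erase j).filter (fun k => dist (y k) (y j) ≤ Rm), lennardJones (dist p (y k))) -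
          ∑ k ∈ (Finset.univ.erase j).filter (fun k => dist (y k) (y j) ≤ Rm), lennardJones (dist (y j) (y k)))
    (hshell : ∀ p : EuclideanSpace ℝ (Fin 3), s₀ ≤ dist p (y j) → dist p (y j) ≤ s →
      -(ε + s * (Rm / (Rm - s)) ^ 7 * (6000 / 343 * Rm⁻¹ ^ 4 + 2880 / 49 * Rm⁻¹ ^ 5 + 10 / 7 * Rm⁻¹ ^ 6 + 2 * Rm⁻¹ ^ 7)) ≤
        (∑ k ∈ (Finset.univ.erase j).filter (fun k => dist (y k) (y j) ≤ Rm), lennardJones (dist p (y k))) -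
          ∑ k ∈ (Finset.univ.erase j).filter (fun k => dist (y k) (y j) ≤ Rm), lennardJones (dist (y j) (y k))) :
    ¬ MoveUnstableCore ε Rm s N y j := by
  have _ := hs₀
  refine not_moveUnstableCore_of_forall fun p hp => ?_
  by_cases hin : dist p (y j) ≤ s₀
  · exact hball p hin
  · push Not at hin
    exact hshell p hin.le hp

/-- ★★ **THREE ZONES** (`s₀ ≤ s₁`): inner ball `‖d‖ ≤ s₀`, middle shell `[s₀, s₁]` (data at radius `s₁`), outer shell `[s₁, s]` (data at radius `s`),
each discharged by the §1 lemma of its kind at the allowance `γ = ε + slack(s, Rm)` ⟹ `¬MoveUnstableCore ε Rm s`. [folklore] -/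
theorem not_moveUnstableCore_of_threeZone {ε Rm s s₀ s₁ : ℝ} {N : ℕ} {y : Fin N → EuclideanSpace ℝ (Fin 3)} {j : Fin N} (hs : s₀ ≤ s₁)
    (hball : ∀ p : EuclideanSpace ℝ (Fin 3), dist p (y j) ≤ s₀ →
      -(ε + s * (Rm / (Rm - s)) ^ 7 * (6000 / 343 * Rm⁻¹ ^ 4 + 2880 / 49 * Rm⁻¹ ^ 5 + 10 / 7 * Rm⁻¹ ^ 6 + 2 * Rm⁻¹ ^ 7)) ≤
        (∑ k ∈ (Finset.univ.erase j).filter (fun k => dist (y k) (y j) ≤ Rm), lennardJones (dist p (y k))) -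
          ∑ k ∈ (Finset.univ.erase j).filter (fun k => dist (y k) (y j) ≤ Rm), lennardJones (dist (y j) (y k)))
    (hmid : ∀ p : EuclideanSpace ℝ (Fin 3), s₀ ≤ dist p (y j) → dist p (y j) ≤ s₁ →
      -(ε + s * (Rm / (Rm - s)) ^ 7 * (6000 / 343 * Rm⁻¹ ^ 4 + 2880 / 49 * Rm⁻¹ ^ 5 + 10 / 7 * Rm⁻¹ ^ 6 + 2 * Rm⁻¹ ^ 7)) ≤
        (∑ k ∈ (Finset.univ.erase j).filter (fun k => dist (y k) (y j) ≤ Rm), lennardJones (dist p (y k))) -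
          ∑ k ∈ (Finset.univ.erase j).filter (fun k => dist (y k) (y j) ≤ Rm), lennardJones (dist (y j) (y k)))
    (hout : ∀ p : EuclideanSpace ℝ (Fin 3), s₁ ≤ dist p (y j) → dist p (y j) ≤ s →
      -(ε + s * (Rm / (Rm - s)) ^ 7 * (6000 / 343 * Rm⁻¹ ^ 4 + 2880 / 49 * Rm⁻¹ ^ 5 + 10 / 7 * Rm⁻¹ ^ 6 + 2 * Rm⁻¹ ^ 7)) ≤
        (∑ k ∈ (Finset.univ.erase j).filter (fun k => dist (y k) (y j) ≤ Rm), lennardJones (dist p (y k))) -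
          ∑ k ∈ (Finset.univ.erase j).filter (fun k => dist (y k) (y j) ≤ Rm), lennardJones (dist (y j) (y k))) :
    ¬ MoveUnstableCore ε Rm s N y j := by
  have _ := hs
  refine not_moveUnstableCore_of_forall fun p hp => ?_
  by_cases h0 : dist p (y j) ≤ s₀
  · exact hball p h0
  · push Not at h0
    by_cases h1 : dist p (y j) ≤ s₁
    · exact hmid p h0.le h1
    · push Not at h1
      exact hout p h1.le hp

/-- ★ **TWO ZONES, fully spelled out** (the form a checker targets): inner anisotropic data at radius `s₀` + outer isotropic data at radius `s` with the
shell condition at `s₀`. [folklore] -/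
theorem not_moveUnstableCore_of_twoZone_data {ε Rm s s₀ : ℝ} {N : ℕ} {y : Fin N → EuclideanSpace ℝ (Fin 3)} {j : Fin N} (hs₀ : 0 ≤ s₀)
    (c₀ Plo₀ Phi₀ : Fin N → ℝ) (beta₀ C4m₀ mu : ℝ) (hC4m₀ : C4m₀ ≤ 0) (hmu : 0 ≤ mu)
    (hrange₀ : ∀ k ∈ (Finset.univ.erase j).filter (fun k => dist (y k) (y j) ≤ Rm), ∀ p : EuclideanSpace ℝ (Fin 3),
      dist p (y j) ≤ s₀ → Plo₀ k ≤ dist p (y k) ^ 2 ∧ dist p (y k) ^ 2 ≤ Phi₀ k)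
    (hbreg₀ : ∀ k ∈ (Finset.univ.erase j).filter (fun k => dist (y k) (y j) ≤ Rm), ∀ P : ℝ, Plo₀ k ≤ P → P ≤ Phi₀ k →
      c₀ k * (P - dist (y j) (y k) ^ 2) ^ 2 ≤
        ((1 / 12) * P⁻¹ ^ 6 - (1 / 6) * P⁻¹ ^ 3) - ((1 / 12) * (dist (y j) (y k) ^ 2)⁻¹ ^ 6 - (1 / 6) * (dist (y j) (y k) ^ 2)⁻¹ ^ 3) -
          (-(1 / 2) * (dist (y j) (y k) ^ 2)⁻¹ ^ 7 + (1 / 2) * (dist (y j) (y k) ^ 2)⁻¹ ^ 4) * (P - dist (y j) (y k) ^ 2))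
    (hB₀ : ‖∑ k ∈ (Finset.univ.erase j).filter (fun k => dist (y k) (y j) ≤ Rm), (4 * c₀ k) • (y j - y k)‖ ≤ beta₀)
    (hC4₀ : C4m₀ ≤ ∑ k ∈ (Finset.univ.erase j).filter (fun k => dist (y k) (y j) ≤ Rm), c₀ k)
    (hN₀ : ∀ d : EuclideanSpace ℝ (Fin 3), ‖d‖ ≤ s₀ →
      0 ≤ ⟪∑ k ∈ (Finset.univ.erase j).filter (fun k => dist (y k) (y j) ≤ Rm),
              (2 * (-(1 / 2) * (dist (y j) (y k) ^ 2)⁻¹ ^ 7 + (1 / 2) * (dist (y j) (y k) ^ 2)⁻¹ ^ 4)) • (y j - y k), d⟫ +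
            ((∑ k ∈ (Finset.univ.erase j).filter (fun k => dist (y k) (y j) ≤ Rm),
                (-(1 / 2) * (dist (y j) (y k) ^ 2)⁻¹ ^ 7 + (1 / 2) * (dist (y j) (y k) ^ 2)⁻¹ ^ 4)) - beta₀ * s₀ + C4m₀ * s₀ ^ 2 + mu) *
              ‖d‖ ^ 2 +
            4 * (∑ k ∈ (Finset.univ.erase j).filter (fun k => dist (y k) (y j) ≤ Rm), c₀ k * ⟪y j - y k, d⟫ ^ 2) +
            (ε + s * (Rm / (Rm - s)) ^ 7 * (6000 / 343 * Rm⁻¹ ^ 4 + 2880 / 49 * Rm⁻¹ ^ 5 + 10 / 7 * Rm⁻¹ ^ 6 + 2 * Rm⁻¹ ^ 7) -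
              mu * s₀ ^ 2))
    (c Plo Phi : Fin N → ℝ) (lam beta phiF C4 : ℝ) (hbeta : 0 ≤ beta)
    (hrange : ∀ k ∈ (Finset.univ.erase j).filter (fun k => dist (y k) (y j) ≤ Rm), ∀ p : EuclideanSpace ℝ (Fin 3),
      dist p (y j) ≤ s → Plo k ≤ dist p (y k) ^ 2 ∧ dist p (y k) ^ 2 ≤ Phi k)
    (hbreg : ∀ k ∈ (Finset.univ.erase j).filter (fun k => dist (y k) (y j) ≤ Rm), ∀ P : ℝ, Plo k ≤ P → P ≤ Phi k →
      c k * (P - dist (y j) (y k) ^ 2) ^ 2 ≤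
        ((1 / 12) * P⁻¹ ^ 6 - (1 / 6) * P⁻¹ ^ 3) - ((1 / 12) * (dist (y j) (y k) ^ 2)⁻¹ ^ 6 - (1 / 6) * (dist (y j) (y k) ^ 2)⁻¹ ^ 3) -
          (-(1 / 2) * (dist (y j) (y k) ^ 2)⁻¹ ^ 7 + (1 / 2) * (dist (y j) (y k) ^ 2)⁻¹ ^ 4) * (P - dist (y j) (y k) ^ 2))
    (hA : ∀ v : EuclideanSpace ℝ (Fin 3),
      lam * ‖v‖ ^ 2 ≤ (∑ k ∈ (Finset.univ.erase j).filter (fun k => dist (y k) (y j) ≤ Rm),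
          (-(1 / 2) * (dist (y j) (y k) ^ 2)⁻¹ ^ 7 + (1 / 2) * (dist (y j) (y k) ^ 2)⁻¹ ^ 4)) * ‖v‖ ^ 2 +
        4 * ∑ k ∈ (Finset.univ.erase j).filter (fun k => dist (y k) (y j) ≤ Rm), c k * ⟪y j - y k, v⟫ ^ 2)
    (hB : ‖∑ k ∈ (Finset.univ.erase j).filter (fun k => dist (y k) (y j) ≤ Rm), (4 * c k) • (y j - y k)‖ ≤ beta)
    (hF : ‖∑ k ∈ (Finset.univ.erase j).filter (fun k => dist (y k) (y j) ≤ Rm),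
      (2 * (-(1 / 2) * (dist (y j) (y k) ^ 2)⁻¹ ^ 7 + (1 / 2) * (dist (y j) (y k) ^ 2)⁻¹ ^ 4)) • (y j - y k)‖ ≤ phiF)
    (hC4 : C4 ≤ ∑ k ∈ (Finset.univ.erase j).filter (fun k => dist (y k) (y j) ≤ Rm), c k)
    (hL : 0 < lam - beta * s + min C4 0 * s ^ 2) (hvert : phiF ≤ 2 * (lam - beta * s + min C4 0 * s ^ 2) * s₀)
    (hcert : phiF * s₀ ≤ (lam - beta * s + min C4 0 * s ^ 2) * s₀ ^ 2 +
      (ε + s * (Rm / (Rm - s)) ^ 7 * (6000 / 343 * Rm⁻¹ ^ 4 + 2880 / 49 * Rm⁻¹ ^ 5 + 10 / 7 * Rm⁻¹ ^ 6 + 2 * Rm⁻¹ ^ 7))) :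
    ¬ MoveUnstableCore ε Rm s N y j :=
  not_moveUnstableCore_of_twoZone hs₀
    (moveEnergy_ge_on_ball_of_aniso c₀ Plo₀ Phi₀ beta₀ C4m₀ mu hC4m₀ hmu hrange₀ hbreg₀ hB₀ hC4₀ hN₀)
    (moveEnergy_ge_on_shell_of_iso c Plo Phi lam beta phiF C4 hbeta hs₀ hrange hbreg hA hB hF hC4 hL hvert hcert)

end Summit.AtomisticToContinuum.Crystallization.Theorems.FrustratedLawDichotomyCollarNonExemptZones

end
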